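import Mathlib
import HarnessLib
import HarnessLib.Audit
import Summits.SmoothPoincare4.Statement
import Literature.Topology.FourManifolds.ConnectedSum
import Literature.Topology.FourManifolds.SphereFamilySurgery

/-!
Route: ThreeFibres

DORMANT since 2026-09-05T00:15:04Z (reconciler: no traction for 5 d (last activity statement-checked at 2026-08-30T23:41:17Z); parked, not closed — `ledger route dormant route-SmoothPoincare4-ThreeFibres --off` to reactivate) — unstaffed, not closed; items shared with open routes are served there. `ledger route dormant <id> --off` reactivates.

# Route ThreeFibres — three fibres of area — push the attaching sphere below 3·Area(fibre) in S²×S²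
and the light-bulb dual appears

It suffices to show X = S1 ∧ AREA₁ (card three-fibres-area-lightbulb-gap, its k = 1 rung typed over
the explicit model
Q = S²×S² ⊂ ℝ³×ℝ³ with product charts (𝓡 2).prod (𝓡 2)). S1 = item StabOneSuffices (crux, rank 3;
rev 1: stated over the bare binders of
SmoothPoincare4 itself — M Hausdorff, second countable, C^∞ on 𝓡 4, e : M ≃ₕ S⁴ — and equivalent to
route Stabilisation's stmt-SmoothPoincare4-0386
modulo the proved compactness/orientability theorems): every such homotopy 4-sphere M has some M #
(S²×S²) ≅ S²×S². AREA₁ = item AreaBelowThreeFibres (crux, rank 2):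
every smoothly embedded sphere f : S² → Q in the fibre class (homotopic to p ↦ (x, p)) with simply
connected complement is carried by
some diffeomorphism ψ of Q to a fibre-class sphere of 2-dimensional Hausdorff measure < 3·μH[2](S²)
("area below three fibres").
The four support items are known theorems that turn AREA₁ into M ≅ S⁴: SurgeryDictionary (M # Q ≅ Q
⇒ M is surgery on such an f),
ThreeFibresSheet (Theorem A of the card: area below three fibres ⇒ some horizontal sphere S²×{y}
meets the sphere in exactly one,
transverse, point — Eilenberg's inequality + Sard + degree), LightBulbFibre (Gabai's 4D light bulb
theorem 1.9: then a diffeomorphism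
carries it onto a fibre {x}×S²), FibreSurgerySphere (surgery on a fibre, any framing, is S⁴). X ⇔
SPC4; the access is that AREA₁ is a
statement about the area of one sphere inside the standard S²×S².
Lean: `open scoped ContDiff in (∀ (M : Type) [TopologicalSpace M] [T2Space M]
[SecondCountableTopology M] [ChartedSpace (EuclideanSpace ℝ (Fin 4)) M] [IsManifold (𝓡 4) ∞ M],
ContinuousMap.HomotopyEquiv M (Metric.sphere (0 : EuclideanSpace ℝ (Fin 5)) 1) → ∃ (P : Type) (_ :
TopologicalSpace P) (_ : ChartedSpace (EuclideanSpace ℝ (Fin 4)) P) (_ : IsManifold (𝓡 4) ∞ P),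
Literature.Topology.FourManifolds.IsConnectedSum (𝓡 4) (𝓡 4) ((𝓡 2).prod (𝓡 2)) M ((Metric.sphere (0
: EuclideanSpace ℝ (Fin 3)) 1) × (Metric.sphere (0 : EuclideanSpace ℝ (Fin 3)) 1)) P ∧ Nonempty (P
≃ₘ⟮𝓡 4, (𝓡 2).prod (𝓡 2)⟯ ((Metric.sphere (0 : EuclideanSpace ℝ (Fin 3)) 1) × (Metric.sphere (0 :
EuclideanSpace ℝ (Fin 3)) 1)))) ∧ (∀ f : (Metric.sphere (0 : EuclideanSpace ℝ (Fin 3)) 1) →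
(Metric.sphere (0 : EuclideanSpace ℝ (Fin 3)) 1) × (Metric.sphere (0 : EuclideanSpace ℝ (Fin 3)) 1),
Manifold.IsSmoothEmbedding (𝓡 2) ((𝓡 2).prod (𝓡 2)) ∞ f → (∃ (x : Metric.sphere (0 : EuclideanSpace
ℝ (Fin 3)) 1) (F G : C(Metric.sphere (0 : EuclideanSpace ℝ (Fin 3)) 1, (Metric.sphere (0 :
EuclideanSpace ℝ (Fin 3)) 1) × (Metric.sphere (0 : EuclideanSpace ℝ (Fin 3)) 1))), ⇑F = f ∧ ⇑G =
(fun p => (x, p)) ∧ F.Homotopic G) → SimplyConnectedSpace ↥(Set.range f)ᶜ → ∃ ψ : ((Metric.sphere (0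
: EuclideanSpace ℝ (Fin 3)) 1) × (Metric.sphere (0 : EuclideanSpace ℝ (Fin 3)) 1)) ≃ₘ⟮(𝓡 2).prod (𝓡
2), (𝓡 2).prod (𝓡 2)⟯ ((Metric.sphere (0 : EuclideanSpace ℝ (Fin 3)) 1) × (Metric.sphere (0 :
EuclideanSpace ℝ (Fin 3)) 1)), (∃ (x : Metric.sphere (0 : EuclideanSpace ℝ (Fin 3)) 1) (F G :
C(Metric.sphere (0 : EuclideanSpace ℝ (Fin 3)) 1, (Metric.sphere (0 : EuclideanSpace ℝ (Fin 3)) 1) ×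
(Metric.sphere (0 : EuclideanSpace ℝ (Fin 3)) 1))), ⇑F = ⇑ψ ∘ f ∧ ⇑G = (fun p => (x, p)) ∧
F.Homotopic G) ∧ μH[2] (Set.range (⇑ψ ∘ f)) < 3 * μH[2] (Set.univ : Set (Metric.sphere (0 :
EuclideanSpace ℝ (Fin 3)) 1)))`

## Assembly
Deciding theorem (PROVED; rev 1 cone repair — planner Sketch.lean / glue.lean: lean check rc 0, 0
sorries, #h21_check_closes ok,
axioms propext · Classical.choice · Quot.sound):
`closes : AreaBelowThreeFibres → StabOneSuffices → SurgeryDictionary → ThreeFibresSheet →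
LightBulbFibre → FibreSurgerySphere → SmoothPoincare4`.
Given M (Hausdorff, second countable, C^∞ on 𝓡 4) and e : M ≃ₕ S⁴ — exactly the binders over which
StabOneSuffices and SurgeryDictionary are
stated since rev 1, so nothing is packaged and no homotopy-sphere / h-cobordism module is imported —
StabOneSuffices M e feeds
SurgeryDictionary, giving the framed sphere ν with embedded fibre-class core and 1-connected
complement and ν.IsSurgery (𝓡 4) M;
AreaBelowThreeFibres gives ψ; ψ ∘ core is again a smooth embedding (proved INLINE in `closes` from
Mathlib's immersion normal form by
transporting the codomain chart along ψ⁻¹ — Mathlib's IsSmoothEmbedding.comp is still proof_wanted,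
and the tree lemma
Manifold.IsSmoothEmbedding.diffeomorph_comp lives in ClosedBallProofs, whose import closure would
carry Cobordism's undischarged Freedman
fact into the cone); ThreeFibresSheet gives the one-sheet height; LightBulbFibre gives φ with φ ∘ ψ
∘ core = fibre inclusion, so
ψ.trans φ standardises the core; FibreSurgerySphere returns Nonempty (M ≃ₘ S⁴). Pure logic
otherwise. Target (rank 0) and the item
Assembly are not hypotheses.

Rationale: WHY THIS LINE. Gabai's light bulb theorem (Gabai2020 = arXiv:1705.09989, Thm 1.9/10.8; Litherland
1986 for the diffeomorphism version) standardises an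
embedded fibre-class sphere B ⊂ S²×S² as soon as ONE horizontal sphere S²×{y} is a transverse sphere
for it, and route Stabilisation's
crux S2 stalls exactly because nobody can produce that dual. The card's move manufactures it by
averaging: for regular y the sheet count
N(y) = |B ⋔ S²×{y}| is odd, and Eilenberg's inequality (Federer1969 2.10.25, constant α(0)α(2)/α(2)
= 1, pr₂ 1-Lipschitz for the sup
metric Mathlib puts on Q) gives ∫ N dμH[2] ≤ μH[2](B); so μH[2](B) < 3·μH[2](S²) forces N(y₀) = 1
for a regular y₀ of positive measure
(Sard1942) — a common transverse sphere appears and B is a fibre. Contrapositively an exotic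
1-stably-standard S⁴ must pay: every sphere in
the Diff(S²×S²)-orbit of its attaching sphere has area ≥ three fibres and ≥ 3 sheets over a.e.
horizontal — an unconditional, quantitative
necessary condition on a fake 4-sphere inside a STANDARD manifold (no invariant of Σ is computed).
Imported: geometric measure theory
(area/coarea formula) to produce the dual, 4-dimensional light-bulb isotopy (Gabai2020) to use it,
Milnor surgery along framed spheres
(MilnorHCobordism1965 Def. 3.11, tree vocabulary FramedSphereFamily/IsSurgery) for the dictionary;
the variational picture (EellsWood1976:
fibres are the only minimal spheres in the class, bubble levels 4π(1+2ℕ)) and the grid calculus of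
the card are the layer-2 engines for
AREA₁. Versus the tree: Stabilisation S2 (stmt-0385) assumes the transverse pair; ThreePointSpheres
fixes three intersection points with
the belt sphere; near-symplectic-ruling sweeps S1 by J-curves — none grades the attaching sphere by
area/sheet number or proves a gap.

RANKED CRUXES. #0 Target (target) — X = S1 ∧ AREA₁: (every homotopy 4-sphere — a Hausdorff
second-countable smooth 4-manifold M with e : M ≃ₕ S⁴, the binders of SmoothPoincare4 (rev 1; rev 0
quantified over the bundled `HomotopySphere 4`, equivalent by the proved compactness/orientability
theorems, planner Bridge.lean) — has some M # (S²×S²) ≅ S²×S²) ∧ (every embedded fibre-class sphere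
in S²×S² with simply connected complement has, in its Diff(S²×S²)-orbit, a fibre-class sphere of
Hausdorff 2-measure below three fibres). (why it might fail: X ⇔ SPC4: an exotic S⁴ needing k ≥ 2
stabilisations kills S1, a 1-stably-standard exotic S⁴ is exactly a sphere violating AREA₁;
candidate families (Gluck twists of non-ribbon 2-knots, CS spheres outside Gompf's classes)
undecided.) [Kirby1997, arXiv:1705.09989, WallJLMS1964, FreedmanGompfMorrisonWalker2010]
#2 AreaBelowThreeFibres (crux) — AREA₁ (card thesis, k = 1, Diff-orbit form): for every C^∞
embedding f : S² → S²×S² homotopic to a fibre inclusion p ↦ (x, p) whose complement is simply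
connected there is a diffeomorphism ψ of S²×S² (product smooth structure) such that ψ ∘ f is again
in the fibre class and μH[2](range (ψ ∘ f)) < 3 · μH[2](S²) (Mathlib Hausdorff measure; sup metric
on the product, round subspace metric on S² ⊂ ℝ³; a fibre has measure exactly μH[2](S²), so standard
spheres pass). Equivalent, given the support items and Gluck's π₀Diff(S²×S¹), to SPC4 for
1-stably-standard homotopy spheres (= Stabilisation's StabCancellation), but stated as an area bound
on one sphere in a standard manifold, with three engines (sheet-number descent / grid calculus,
constrained min-max at the 12π level, mapping-class moves). [difficulty: open-problem] (why it might
fail: ⇔ SPC4 on 1-stably-standard Σ: a fibre-class sphere with 1-connected complement stuck at ≥ 3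
sheets in its whole Diff-orbit IS an exotic S⁴; in codimension 2 area-decreasing deformations need
not stay embedded, so no flow is known to reach < 3 fibres.) [arXiv:1705.09989, Gabai2020,
Federer1969, EellsWood1976, FreedmanGompfMorrisonWalker2010, arXiv:1406.4937]
#3 StabOneSuffices (crux) — S1, ONE STABILISATION SUFFICES, stated (rev 1, cone repair) over the
bare binders of SmoothPoincare4 itself (M Hausdorff, second countable, C^∞ on 𝓡 4, e : M ≃ₕ S⁴; M is
then compact and orientable by the PROVED tree theorems
compactSpace_of_homotopyEquiv_sphere_four_holds / isOrientable_of_homotopyEquiv_sphere_four_holds,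
which provers may invoke — neither is a hypothesis, so the route imports no homotopy-sphere /
h-cobordism module): some connected sum M # (S²×S²) (relational IsConnectedSum, sum modelled on 𝓡 4,
S²×S² on (𝓡 2).prod (𝓡 2)) is diffeomorphic to S²×S². EQUIVALENT to item stmt-SmoothPoincare4-0386
of route Stabilisation (its `HomotopySphere 4` form; rev 0 of this item was definitionally equal to
it) — planner Bridge.lean proves both directions with standard axioms, so a proof of either closes
the other in six lines. Wall + Θ₄ = 0 give M # k(S²×S²) ≅ # k(S²×S²) for SOME k; the crux is k = 1
(the card's AREA_k for k ≥ 2 needs k-fold connected-sum models Lean lacks, see Not decomposed yet).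
[difficulty: open-problem] (why it might fail: Wall gives SOME k; k = 1 is Stern's problem on
homotopy spheres, open even for Gluck twists of non-ribbon 2-knots; one S²×S² does not undo every
cork (Kang2022OneStabilization Thm 1.1), so an exotic Σ needing k ≥ 2 kills S1 (not SPC4).)
[WallJLMS1964, KervaireMilnorAnnals1963, Kang2022OneStabilization, KasprowskiPowellRay2023,
AkbulutYasui2013, arXiv:1009.0514, Literature.Barriers.SmoothPoincare4.OneStabilisationBarrier]
#9 SurgeryDictionary (support) — DICTIONARY (card P2(i), known surgery theory; rev 1: same bare
binders as StabOneSuffices instead of `S : HomotopySphere 4`, same content — Bridge.lean): if e : M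
≃ₕ S⁴ and M # (S²×S²) ≅ S²×S² then M is obtained from Q = S²×S² by Milnor surgery (tree
FramedSphereFamily.IsSurgery, type (3,2)) along a framed 2-sphere ν whose core ν.sphere 0 is a C^∞
embedding in the fibre class with simply connected complement. Proof: A = image of a fibre of the
Q-side of M # Q; surgery on A gives M # S⁴ ≅ M; complement ≅ M # (ℝ²×S²) is 1-connected; push
forward by the diffeomorphism d : M # Q → Q and normalise the class d_*[A] ∈ {±F, ±G} (primitive,
square 0) to +F by swap / (id × reflection). Formalisation-heavy (transport of open gluings:
boundaryless models only, so the OpenGluingCounterexample artefact does not arise), mathematically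
routine; compactness of M, where wanted, from compactSpace_of_homotopyEquiv_sphere_four_holds.
[difficulty: L] [MilnorHCobordism1965, WallJLMS1964, GompfStipsicz1999, KervaireMilnorAnnals1963]
#9 ThreeFibresSheet (support) — THEOREM A (card P1/P5, provable now on paper): a C^∞ embedded
fibre-class sphere g : S² → S²×S² with μH[2](range g) < 3 · μH[2](S²) has a ONE-SHEET HEIGHT: some y
∈ S² with exactly one p such that (g p).2 = y, and d(pr₂ ∘ g) surjective at every such p (y a
regular value) — i.e. S²×{y} is a transverse sphere for g. Proof: deg(pr₂ ∘ g) = 1 (fibre class) so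
N(y) = #(pr₂ ∘ g)⁻¹(y) is odd ≥ 1 at regular values (a.e. y, Sard); Eilenberg's inequality ∫* N
dμH[2] ≤ Lip(pr₂)² μH[2](range g) with Lip(pr₂) = 1 in the sup metric and normalisation-free
constant; if N ≥ 3 a.e. then 3 μH[2](S²) ≤ μH[2](range g), contradiction. Needs Eilenberg/coarea
inequality and Sard for maps S² → S² in Mathlib form (not yet there: M-size formalisation).
[difficulty: M] [Federer1969, Sard1942, EvansGariepy2015, arXiv:1705.09989]
#9 LightBulbFibre (support) — 4D LIGHT BULB THEOREM, Diff-orbit form (Gabai2020 Thm 1.9 = 10.8,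
verbatim p.3: "If R is an embedded 2-sphere in S²×S², homologous to x₀×S², that intersects S²×y₀
transversely and only at the point (x₀, y₀), then R is isotopic to x₀×S² via an isotopy fixing S²×y₀
pointwise"; Litherland 1986 Proc. AMS 98 already gives a diffeomorphism): a C^∞ embedded fibre-class
sphere g with a one-sheet height is carried by a diffeomorphism φ of S²×S² EXACTLY onto a fibre
inclusion, φ (g p) = (x, p) (the reparametrisation σ = pr₂ ∘ Φ₁ ∘ g ∈ Diff(S²) left by the isotopy
Φ₁ is absorbed into φ := (id × σ⁻¹) ∘ Φ₁). XL to formalise; may be re-filed as `(h : <Gabai 1.9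
named fact>) → …` once the fact is vendored (Definition requests). [difficulty: XL] [Gabai2020,
arXiv:1705.09989, Smale1959]
#9 FibreSurgerySphere (support) — SURGERY ON A FIBRE IS S⁴ (card P2(ii), known): if the core of a
framed 2-sphere ν in Q = S²×S² is carried by a diffeomorphism exactly onto a fibre {x}×S², then
every 4-manifold M obtained from Q by surgery along ν (tree IsSurgery, WHATEVER the framing ν
carries) is diffeomorphic to S⁴. Proof: Q = ∂(D³×S²_b) with the 2-handle's belt sphere S²_a×{b₀} met
once by the fibre {x}×S²_b, so attaching a 3-handle along the fibre with any framing cancels the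
2-handle: surgery = ∂D⁵ = S⁴; transport along the diffeomorphism; uniqueness of open gluings up to
diffeomorphism. Needs: gluing uniqueness + one explicit model computation (L). [difficulty: L]
[MilnorHCobordism1965, GompfStipsicz1999, Gluck1962]

TWO-LAYER PLAN. Foreseen glued split of AreaBelowThreeFibres (k = 2, depth 1), to file when a prover
or refuter engages: C₁ SheetDescent (crux; the card's
complexity (c) and the parent of its grid calculus K1/K3): for every embedded fibre-class f with
1-connected complement and minimal sheet
number n(f) := min over regular y of #(pr₂∘f)⁻¹(y) ≥ 3 there is ψ ∈ Diff(S²×S²) with ψ∘f fibre-class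
and n(ψ∘f) < n(f); C₂ (support,
provable): regular values exist and carry odd sheet counts (Sard + degree), and a sphere with n = 1
is carried onto a fibre (LightBulbFibre)
hence to measure μH[2](S²) < 3 μH[2](S²); glue C₁ → C₂ → AreaBelowThreeFibres by well-founded
induction on n. Alternative split (a
separate decomposition, same node): GridNormalForm (K3: double squash to n vertical + 2m horizontal
flat sheets and a planar filling P of the
grid link Γ_(n,2m) in a corner ball) → GridReduction (K1: every grid sphere with 1-connected
complement reduces to n = 1 by band
cancellations / braid–Markov grid moves) → AreaBelowThreeFibres — needs the definitions
`sheetNumber`, `gridSphere` first. The variational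
engine K2 (every ISOTOPY class contains spheres below 12π; Eells–Wood rigidity: fibres are the only
minimal spheres in the class, 12π level
= necklaces) is the stronger isotopy form of C₁ and would be filed as a sibling crux, not a third
layer.

KILL CRITERIA. A refutation of AreaBelowThreeFibres (an embedded fibre-class sphere with simply
connected complement whose whole Diff-orbit stays at
≥ three fibres — certified e.g. by an exotic surgery manifold) or of StabOneSuffices (a homotopy
4-sphere needing k ≥ 2) exhibits an exotic
S⁴: close `refuted:<Decl>` together with the positive side and hand the witness to route
ZeroSurgeryExotic / the negative side. A refutation
of a SUPPORT item can only be a mis-typing (sup-metric normalisation, IsOpenGluing transport,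
orientation of the fibre class): repair as
misstated, never a kill. Soft kills: StabCancellation (Stabilisation S2, stmt-0385) proved by other
means ⇒ AreaBelowThreeFibres follows via
the converse dictionary — close `superseded --by route-SmoothPoincare4-Stabilisation`; a printed
"area below three fibres ⇒ transverse
sphere" lemma downgrades novelty but not the route. Pivot trigger: S1 refuted but SPC4 open ⇒
re-type AREA_k over a #k(S²×S²) model
(card's general k) instead of closing.

NOT DECOMPOSED YET. (a) AREA_k for k ≥ 2 (the card's full thesis: Σ_i Area(B_i ∩ U_j) < 12π − 3|D_j|
in every summand U_j of the k-fold sum, Gabai Thm 10.1): needs a smooth model of the k-fold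
connected sum of copies of S²×S² (iterated IsConnectedSum with bookkeeping of the summands), not in
the tree; filed only if StabOneSuffices is refuted while SPC4 stays open (pivot trigger). (b) The
layer-2 splits of AreaBelowThreeFibres (SheetDescent; GridNormalForm → GridReduction; the
variational sibling) described under TWO-LAYER PLAN — filed when a prover or refuter engages, with
the definitions sheetNumber / gridSphere. (c) Vendoring Gabai 1.9 and Federer 2.10.25 as named
Literature facts (would turn LightBulbFibre / ThreeFibresSheet into `(h : Fact) → …` bridges) —
deliberately NOT done at this rev: an undischarged cite fact in the cone de-staffs the route. (d)
The negative side (¬AreaBelowThreeFibres certified by an exotic surgery manifold) is route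
ZeroSurgeryExotic's business.

CHEAPEST FALSIFIER. Run first, in Lean, on the typed threshold: show 0 < μH[2](Set.univ : Set S²) <
⊤ and μH[2](range (fun p ↦ (x, p))) = μH[2](S²) in Q
(isometric embedding for the sup metric), so that the fibre itself satisfies AreaBelowThreeFibres'
inequality and violates nothing — if
either failed (a normalisation slip making `< 3 * μH[2] univ` vacuous or unsatisfiable) every item
would be mis-typed at once. DONE 2026-08-15 by refuter-rattack-stmt-SmoothPoincare4-14758-0
(Evidence.lean on stmt-14758, sorry-free): 0 < μH[2](S²) < ⊤, the
fibre inclusion is an isometry, the standard fibre passes with ψ = refl — non-vacuous, no slip.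
Second: the
π₁-hypothesis probe — a 2-knot group with a linking-number-one element that is not a weight element
yields a primitive square-zero sphere
in S²×S² with non-simply-connected complement, confirming the hypothesis `SimplyConnectedSpace
(range f)ᶜ` cannot be dropped (consistency,
not a kill). Third (lookup, done 2026-08-15, negative): a printed "area < 3·Area(fibre) ⇒ light-bulb
position" remark in Gabai2020 §10,
Litherland 1986, AKMR arXiv:1406.4937. Beyond these every falsifier of a crux is an exotic S⁴
(SPC4-hard); for S1 the refuter's cheapest
concrete move is Kirby calculus on Gluck twists # S²×S² (GompfStipsicz1999 Ex. 5.2.7(b) pattern).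

NUMBERS. Three fibres = 3 · Area(S²) = 12π in the unit product metric; typed normalisation-free as
μH[2](range) < 3 · μH[2](S²) (Mathlib μH has no
ω-normalisation; sup metric on the product only lowers the left side, d_∞ ≤ d_2). Eilenberg constant
for k = 0: α(0)α(2)/α(2) = 1
(Federer1969 2.10.25); Lip(pr₂) = 1. Harmonic/min-max levels in the fibre class: 4π(1+2ℕ), first
obstruction level 12π (EellsWood1976).
Sheet counts N(y) ≡ 1 mod 2 at regular values; a fibre has N ≡ 1. Items at open: 8 (2 cruxes, 1
target, 4 support, 1 assembly). Cone (rev 1): route imports 7 → 2 (ConnectedSum,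
SphereFamilySurgery; dropped HomotopySpheres,
SmoothOrientation, HomotopyS4CompactProofs, HomotopyS4OrientableProofs, ClosedBallProofs); module
import closure = Statement(+SPC4Wave0), ConnectedSum,
SmoothOrientation, SphereFamilySurgery, CircleSurgery, MappingTorus (+HarnessLib); unproved closed
named facts in it 16 → 13, all 13 in SPC4Wave0 via the
operator-owned Statement import (summit-wide floor, needs operator); gate used-constants cone 27
project constants, 0 unproved (Sketch.lean #h21_route_deps).

DEFINITION REQUESTS. None needed to state the eight items (FramedSphereFamily, IsSurgery,
IsConnectedSum, ContinuousMap.HomotopyEquiv, Manifold.IsSmoothEmbedding,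
μH, mfderiv, ContinuousMap.Homotopic all exist; HomotopySphere deliberately not used since rev 1).
Wanted later (layer 2): `sheetNumber` (min over regular values of the preimage count of
pr₂ ∘ f) and `gridSphere` under Summits/SmoothPoincare4/SmoothPoincare4/Theorems; cite facts worth
vendoring: Gabai2020 Thm 1.9 (4D light
bulb theorem in S²×S²) and Federer1969 2.10.25 (Eilenberg inequality) — each would turn a support
item into `(h : Fact) → …`.

Novelty: Searches (2026-08-15, this seat + the card's mechanism hunt and its refuter triage the same day):
`lit read arxiv:1705.09989 --grep
"S^2 x S^2|transversely|Theorem 10.|Theorem 1."` (27 hits; Thm 1.9/3.1/10.1/10.8 read verbatim;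
Litherland [Li] located); `lit search --hybrid
"light bulb theorem S^2 x S^2 embedded sphere transverse sphere area bound coarea"` (15, noise:
Freedman–Quinn pp.77–87, Juhász 2023);
`lit galaxy search "light bulb theorem" --star all` (0), `"knotted spheres in S2 x S2" --star all`
(0), `"transverse sphere" --star pdf` (13,
physics noise + Freedman 2013 lectures, Teichner slice notes); card: arXiv "light bulb theorem
4-manifold spheres isotopy" (4: Gabai,
Schneiderman–Teichner, Cha–Kim 2303.12857, Kosanović–Teichner), "area bound unknotting surface four
manifold" (0/429), `lit frontier
SmoothPoincare4 --since 2023` (30; four read); searchd/openalex intermittently unavailable (rc 75)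
during this seat.
Nearest prior art found: Gabai2020 (arXiv:1705.09989) Thm 1.9/10.1 — the engine, with the transverse
sphere as HYPOTHESIS and no area or
sweep argument in §10's questions; Litherland 1986 (diffeomorphism version); arXiv:1406.4937 (AKMR,
stable isotopy after one S²×S²);
Gromov1985/McDuff1990 rulings (positivity of intersections gives N ≡ 1 for J-spheres — the
symplectic shadow of Theorem A); in the tree,
route Stabilisation crux S2 (stmt-0385, assumes the dual) and route ThreePointSpheres (three-point
pairs), card near-symplectic-ruling.
Delta: nobody produce  [refs: 1705.09989, 1406.4937, arxiv:1705.09989, Gabai2020, Gromov1985, McDuff1990]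

Barriers (technique_class: measure-theoretic-duals, light-bulb-isotopy, area): - technique_class: measure-theoretic-duals, light-bulb-isotopy, area
- Literature.Barriers.SmoothPoincare4.HCobordismBarrierFour: (Donaldson: smooth 5-dimensional
h-cobordisms need not be products) the line never asserts "h-cobordant ⇒ diffeomorphic"; it gives a
CHECKABLE sufficient condition on the attaching sphere and the card's P4 shows the condition fails
exactly on 1-stably diffeomorphic exotic pairs (b₂ > 0), so it is not a disguised general
cancellation principle; the S⁴-specific input is the total double ruling of S²×S² (every bit of area
is seen by the sweep). At b₂ = 0 the crux is SPC4-hard — conceded.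
- Literature.Barriers.SmoothPoincare4.OneStabilisationBarrier: (Kang: one S²×S² does not undo every
cork) hits StabOneSuffices only, which escapes by scope (closed, b₂ = 0, Kang's open Question 1);
AreaBelowThreeFibres is a statement inside S²×S² and does not claim one stabilisation suffices for
anything else.
- Literature.Barriers.SmoothPoincare4.HCobordismInvariantBarrierFour: void — no invariant of Σ or of
its h-cobordism class is computed; the graded quantity is the area / sheet number of a sphere in a
standard manifold, which distinguishes h-cobordant tops (P4).
- Literature.Barriers.SmoothPoincare4.StableBarrierFour: void for the same reason (nothing stable is
evaluated); on the negative side a refuter needs an unstable certificate (an exotic surgery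
manifold), as for every SPC4 route.
- Literature.Barriers.SmoothPoincare4.GaugeSumBarrierFour: void — no SW/Donal

History (route lifecycle, newest last):
- 2026-08-15T20:08:45Z · rev 1: restated Target (stmt-SmoothPoincare4-14757), StabOneSuffices (stmt-SmoothPoincare4-14759), SurgeryDictionary (stmt-SmoothPoincare4-14760) — route-repair (cone, gen 1; unit rrepair-SmoothPoincare4-ThreeFibres-3cd672f8): RE-ROUTED AROUND the 3 route-side facts; needs-fact: NONE of the 16. Diagnosis (p (planner-rrepair-SmoothPoincare4-ThreeFibres-3cd672f8-0)
- 2026-08-23T02:10:18Z · DORMANT — reconciler: no traction for 5.8 d (last activity item-evidence-added at 2026-08-17T05:07:31Z); parked, not closed — `ledger route dormant route-SmoothPoincare4- (operator:999:2841310)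
- 2026-08-30T14:34:43Z · REACTIVATED — reconciler: reactivated — activity statement-checked at 2026-08-30T13:47:04Z after parking at 2026-08-23T02:10:18Z (operator:999:3836036)
- 2026-09-05T00:15:04Z · DORMANT — reconciler: no traction for 5 d (last activity statement-checked at 2026-08-30T23:41:17Z); parked, not closed — `ledger route dormant route-SmoothPoincare4-Thre (operator:999:560063)

sub-problem: SmoothPoincare4 · status: dormant · opened planner-plancard-SmoothPoincare4-SmoothPoinca-8ad3f007-0 2026-08-15T19:11:57Z · rev 1 · ledger route-SmoothPoincare4-ThreeFibres
GENERATED by the gate from the ledger (D-0016/17). Provers cite these decls: `theorem foo : Summit.SmoothPoincare4.SmoothPoincare4.Theses.ThreeFibres.<Decl> := …` in Summits/SmoothPoincare4/SmoothPoincare4/Theorems/<Name>.lean.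
-/

namespace Summit.SmoothPoincare4.SmoothPoincare4.Theses.ThreeFibres

open scoped BigOperators Topology Manifold Classical MeasureTheory ProbabilityTheory Matrix InnerProductSpace ComplexConjugate ContinuousMap ContDiff
open Filter Set Function TopologicalSpace MeasureTheory

attribute [summit_statement] _root_.SmoothPoincare4

open Literature.SPC4

-- earlier Target (stmt-SmoothPoincare4-14757, replaced 2026-08-15T20:08:45Z -> stmt-SmoothPoincare4-13901): retired by None — open scoped ContDiff in (∀ S : Literature.Topology.FourManifolds.HomotopySphere 4, ∃ (P : Type) (_ : TopologicalSpace P) (_ : ChartedSpace (EuclideanSpace ℝ (Fin 4)) P) (_ : IsManifold (𝓡 4) ∞ P), Literature.Topology.FourManifolds.IsConnectedSum (𝓡 4) (𝓡 4) ((𝓡 2).prod (𝓡 2))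
/-- item stmt-SmoothPoincare4-13901 · target · rank 0 · open · by planner
why it might fail: X ⇔ SPC4: an exotic S⁴ needing k ≥ 2 stabilisations kills S1, a 1-stably-standard exotic S⁴ is exactly a sphere violating AREA₁; candidate families (Gluck twists of non-ribbon 2-knots, CS spheres outside Gompf's classes) undecided.
sources: Kirby1997, arXiv:1705.09989, WallJLMS1964, FreedmanGompfMorrisonWalker2010
[target] X = S1 ∧ AREA₁ — rev 1 (cone repair): the S1 conjunct is stated over the bare binders of
SmoothPoincare4 (M Hausdorff, second countable, C^∞ on 𝓡 4, e : M ≃ₕ S⁴) instead of `S :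
HomotopySphere 4` (equivalent, planner Bridge.lean); the AREA₁ conjunct is item AreaBelowThreeFibres
verbatim: (every such homotopy 4-sphere M has some M # (S²×S²) ≅ S²×S²) ∧ (every embedded
fibre-class sphere in S²×S² with simply connected complement has, in its Diff(S²×S²)-orbit, a
fibre-class sphere of Hausdorff 2-measure below three fibres). -/
@[route_item "route-SmoothPoincare4-ThreeFibres"]
def Target : Prop :=
  open scoped ContDiff in (∀ (M : Type) [TopologicalSpace M] [T2Space M] [SecondCountableTopology M] [ChartedSpace (EuclideanSpace ℝ (Fin 4)) M] [IsManifold (𝓡 4) ∞ M], ContinuousMap.HomotopyEquiv M (Metric.sphere (0 : EuclideanSpace ℝ (Fin 5)) 1) → ∃ (P : Type) (_ : TopologicalSpace P) (_ : ChartedSpace (EuclideanSpace ℝ (Fin 4)) P) (_ : IsManifold (𝓡 4) ∞ P), Literature.Topology.FourManifolds.IsConnectedSum (𝓡 4) (𝓡 4) ((𝓡 2).prod (𝓡 2)) M ((Metric.sphere (0 : EuclideanSpace ℝ (Fin 3)) 1) × (Metric.sphere (0 : EuclideanSpace ℝ (Fin 3)) 1)) P ∧ Nonempty (P ≃ₘ⟮𝓡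 4, (𝓡 2).prod (𝓡 2)⟯ ((Metric.sphere (0 : EuclideanSpace ℝ (Fin 3)) 1) × (Metric.sphere (0 : EuclideanSpace ℝ (Fin 3)) 1)))) ∧ (∀ f : (Metric.sphere (0 : EuclideanSpace ℝ (Fin 3)) 1) → (Metric.sphere (0 : EuclideanSpace ℝ (Fin 3)) 1) × (Metric.sphere (0 : EuclideanSpace ℝ (Fin 3)) 1), Manifold.IsSmoothEmbedding (𝓡 2) ((𝓡 2).prod (𝓡 2)) ∞ f → (∃ (x : Metric.sphere (0 : EuclideanSpace ℝ (Fin 3)) 1) (F G : C(Metric.sphere (0 : EuclideanSpace ℝ (Fin 3)) 1, (Metric.sphere (0 : EuclideanSpace ℝ (Fin 3)) 1) × (Metric.sphere (0 : EuclideanSpace ℝ (Fin 3)) 1))), ⇑F = f ∧ ⇑G = (fun p => (x, p)) ∧ F.Homotopic G) → SimplyConnectedSpace ↥(Set.range f)ᶜ → ∃ ψ : ((Metric.sphere (0 : EuclideanSpace ℝ (Fin 3)) 1) × (Metric.sphere (0 : EuclideanSpace ℝ (Fin 3)) 1)) ≃ₘ⟮(𝓡 2).prod (𝓡 2), (𝓡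 2).prod (𝓡 2)⟯ ((Metric.sphere (0 : EuclideanSpace ℝ (Fin 3)) 1) × (Metric.sphere (0 : EuclideanSpace ℝ (Fin 3)) 1)), (∃ (x : Metric.sphere (0 : EuclideanSpace ℝ (Fin 3)) 1) (F G : C(Metric.sphere (0 : EuclideanSpace ℝ (Fin 3)) 1, (Metric.sphere (0 : EuclideanSpace ℝ (Fin 3)) 1) × (Metric.sphere (0 : EuclideanSpace ℝ (Fin 3)) 1))), ⇑F = ⇑ψ ∘ f ∧ ⇑G = (fun p => (x, p)) ∧ F.Homotopic G) ∧ μH[2] (Set.range (⇑ψ ∘ f)) < 3 * μH[2] (Set.univ : Set (Metric.sphere (0 : EuclideanSpace ℝ (Fin 3)) 1)))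

/-- item stmt-SmoothPoincare4-14758 · crux · rank 2 · open · by planner
why it might fail: ⇔ SPC4 on 1-stably-standard Σ: a fibre-class sphere with 1-connected complement stuck at ≥ 3 sheets in its whole Diff-orbit IS an exotic S⁴; in codimension 2 area-decreasing deformations need not stay embedded, so no flow is known to reach < 3 fibres.
sources: arXiv:1705.09989, Gabai2020, Federer1969, EellsWood1976, FreedmanGompfMorrisonWalker2010, arXiv:1406.4937
[crux] AREA₁ (card thesis, k = 1, Diff-orbit form): for every C^∞ embedding f : S² → S²×S² homotopic
to a fibre inclusion p ↦ (x, p) whose complement is simply connected there is a diffeomorphism ψ of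
S²×S² (product smooth structure) such that ψ ∘ f is again in the fibre class and μH[2](range (ψ ∘
f)) < 3 · μH[2](S²) (Mathlib Hausdorff measure; sup metric on the product, round subspace metric on
S² ⊂ ℝ³; a fibre has measure exactly μH[2](S²), so standard spheres pass). Equivalent, given the
support items and Gluck's π₀Diff(S²×S¹), to SPC4 for 1-stably-standard homotopy spheres (=
Stabilisation's StabCancellation), but stated as an area bound on one sphere in a standard manifold,
with three engines (sheet-number descent / grid calculus, constrained min-max at the 12π level,
mapping-class moves). [difficulty: open-problem] -/
@[route_item "route-SmoothPoincare4-ThreeFibres"]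
def AreaBelowThreeFibres : Prop :=
  open scoped ContDiff in ∀ f : (Metric.sphere (0 : EuclideanSpace ℝ (Fin 3)) 1) → (Metric.sphere (0 : EuclideanSpace ℝ (Fin 3)) 1) × (Metric.sphere (0 : EuclideanSpace ℝ (Fin 3)) 1), Manifold.IsSmoothEmbedding (𝓡 2) ((𝓡 2).prod (𝓡 2)) ∞ f → (∃ (x : Metric.sphere (0 : EuclideanSpace ℝ (Fin 3)) 1) (F G : C(Metric.sphere (0 : EuclideanSpace ℝ (Fin 3)) 1, (Metric.sphere (0 : EuclideanSpace ℝ (Fin 3)) 1) × (Metric.sphere (0 : EuclideanSpace ℝ (Fin 3)) 1))), ⇑F = f ∧ ⇑G = (fun p => (x, p)) ∧ F.Homotopic G) → SimplyConnectedSpace ↥(Set.range f)ᶜ → ∃ ψ : ((Metric.sphere (0 : EuclideanSpace ℝ (Fin 3)) 1) × (Metric.sphere (0 : EuclideanSpace ℝ (Fin 3)) 1)) ≃ₘ⟮(𝓡 2).prod (𝓡 2), (𝓡 2).prod (𝓡 2)⟯ ((Metric.sphere (0 : EuclideanSpace ℝ (Fin 3)) 1) × (Metric.sphere (0 : EuclideanSpace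 ℝ (Fin 3)) 1)), (∃ (x : Metric.sphere (0 : EuclideanSpace ℝ (Fin 3)) 1) (F G : C(Metric.sphere (0 : EuclideanSpace ℝ (Fin 3)) 1, (Metric.sphere (0 : EuclideanSpace ℝ (Fin 3)) 1) × (Metric.sphere (0 : EuclideanSpace ℝ (Fin 3)) 1))), ⇑F = ⇑ψ ∘ f ∧ ⇑G = (fun p => (x, p)) ∧ F.Homotopic G) ∧ μH[2] (Set.range (⇑ψ ∘ f)) < 3 * μH[2] (Set.univ : Set (Metric.sphere (0 : EuclideanSpace ℝ (Fin 3)) 1))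

-- earlier StabOneSuffices (stmt-SmoothPoincare4-14759, replaced 2026-08-15T20:08:45Z -> stmt-SmoothPoincare4-13902): retired by None — open scoped ContDiff in ∀ S : Literature.Topology.FourManifolds.HomotopySphere 4, ∃ (P : Type) (_ : TopologicalSpace P) (_ : ChartedSpace (EuclideanSpace ℝ (Fin 4)) P) (_ : IsManifold (𝓡 4) ∞ P), Literature.Topology.FourManifolds.IsConnectedSum (𝓡 4) (𝓡 4) ((𝓡 2).pro
/-- item stmt-SmoothPoincare4-13902 · crux · rank 3 · open · by planner
why it might fail: Wall gives SOME k; k = 1 is Stern's problem on homotopy spheres, open even for Gluck twists of non-ribbon 2-knots; one S²×S² does not undo every cork (Kang2022OneStabilization Thm 1.1), so an exotic Σ needing k ≥ 2 kills S1 (not SPC4).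
sources: WallJLMS1964, KervaireMilnorAnnals1963, Kang2022OneStabilization, KasprowskiPowellRay2023, AkbulutYasui2013, arXiv:1009.0514
[crux] S1, ONE STABILISATION SUFFICES — rev 1 (cone repair): stated over the bare binders of
SmoothPoincare4 itself (M Hausdorff, second countable, C^∞ on 𝓡 4, e : M ≃ₕ S⁴; M is then compact
and orientable by the PROVED tree theorems compactSpace_of_homotopyEquiv_sphere_four_holds /
isOrientable_of_homotopyEquiv_sphere_four_holds, which provers may invoke — neither is a hypothesis,
so the route imports no homotopy-sphere / h-cobordism module). EQUIVALENT to item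
stmt-SmoothPoincare4-0386 of route Stabilisation (`∀ S : HomotopySphere 4, …`; rev 0 of this item,
stmt-SmoothPoincare4-14759, was definitionally equal to it): planner Bridge.lean proves both
directions with standard axioms, so a proof of either closes the other in six lines. Content: for
every such homotopy 4-sphere M some connected sum M # (S²×S²) (relational IsConnectedSum, sum
modelled on 𝓡 4, S²×S² on (𝓡 2).prod (𝓡 2)) is diffeomorphic to S²×S². Wall + Θ₄ = 0 give M #
k(S²×S²) ≅ # k(S²×S²) for SOME k; the crux is k = 1. [difficulty: open-problem] -/
@[route_item "route-SmoothPoincare4-ThreeFibres"]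
def StabOneSuffices : Prop :=
  open scoped ContDiff in ∀ (M : Type) [TopologicalSpace M] [T2Space M] [SecondCountableTopology M] [ChartedSpace (EuclideanSpace ℝ (Fin 4)) M] [IsManifold (𝓡 4) ∞ M], ContinuousMap.HomotopyEquiv M (Metric.sphere (0 : EuclideanSpace ℝ (Fin 5)) 1) → ∃ (P : Type) (_ : TopologicalSpace P) (_ : ChartedSpace (EuclideanSpace ℝ (Fin 4)) P) (_ : IsManifold (𝓡 4) ∞ P), Literature.Topology.FourManifolds.IsConnectedSum (𝓡 4) (𝓡 4) ((𝓡 2).prod (𝓡 2)) M ((Metric.sphere (0 : EuclideanSpace ℝ (Fin 3)) 1) × (Metric.sphere (0 : EuclideanSpace ℝ (Fin 3)) 1)) P ∧ Nonempty (P ≃ₘ⟮𝓡 4, (𝓡 2).prod (𝓡 2)⟯ ((Metric.sphere (0 : EuclideanSpace ℝ (Fin 3)) 1) × (Metric.sphere (0 : EuclideanSpace ℝ (Fin 3)) 1)))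

-- earlier SurgeryDictionary (stmt-SmoothPoincare4-14760, replaced 2026-08-15T20:08:45Z -> stmt-SmoothPoincare4-13903): retired by None — open scoped ContDiff in ∀ S : Literature.Topology.FourManifolds.HomotopySphere 4, (∃ (P : Type) (_ : TopologicalSpace P) (_ : ChartedSpace (EuclideanSpace ℝ (Fin 4)) P) (_ : IsManifold (𝓡 4) ∞ P), Literature.Topology.FourManifolds.IsConnectedSum (𝓡 4) (𝓡 4) ((𝓡 2).
/-- item stmt-SmoothPoincare4-13903 · support · rank 9 · open · by planner
sources: MilnorHCobordism1965, WallJLMS1964, GompfStipsicz1999, KervaireMilnorAnnals1963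
[support] DICTIONARY (card P2(i), known surgery theory) — rev 1 (cone repair): same bare binders as
StabOneSuffices (M Hausdorff, second countable, C^∞ on 𝓡 4, e : M ≃ₕ S⁴) instead of `S :
HomotopySphere 4`, same content (planner Bridge.lean: old ↔ new, standard axioms): if M # (S²×S²) ≅
S²×S² then M is obtained from Q = S²×S² by Milnor surgery (tree FramedSphereFamily.IsSurgery, type
(3,2)) along a framed 2-sphere ν whose core ν.sphere 0 is a C^∞ embedding in the fibre class
(homotopic to p ↦ (x, p)) with simply connected complement. Proof: A = image of a fibre of the
Q-side of M # Q; surgery on A gives M # S⁴ ≅ M; complement ≅ M # (ℝ²×S²) is 1-connected; push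
forward by the diffeomorphism d : M # Q → Q and normalise the class d_*[A] ∈ {±F, ±G} (primitive,
square 0) to +F by swap / (id × reflection). Formalisation-heavy (transport of open gluings:
boundaryless models only, so the OpenGluingCounterexample artefact does not arise), mathematically
routine; compactness of M, where wanted, from the proved
compactSpace_of_homotopyEquiv_sphere_four_holds. PROVER NOTE: prefer Mathlib-level imports;
importing HomotopySpheres / ClosedBallProofs / IsotopyProofs in the closing Theorems file r -/
@[route_item "route-SmoothPoincare4-ThreeFibres"]
def SurgeryDictionary : Prop :=
  open scoped ContDiff in ∀ (M : Type) [TopologicalSpace M] [T2Space M] [SecondCountableTopology M] [ChartedSpace (EuclideanSpace ℝ (Fin 4)) M] [IsManifold (𝓡 4) ∞ M], ContinuousMap.HomotopyEquiv M (Metric.sphere (0 : EuclideanSpace ℝ (Fin 5)) 1) → (∃ (P : Type) (_ : TopologicalSpace P) (_ : ChartedSpace (EuclideanSpace ℝ (Fin 4)) P) (_ : IsManifold (𝓡 4) ∞ P), Literature.Topology.FourManifolds.IsConnectedSum (𝓡 4) (𝓡 4) ((𝓡 2).prod (𝓡 2)) M ((Metric.sphere (0 : EuclideanSpace ℝ (Fin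 3)) 1) × (Metric.sphere (0 : EuclideanSpace ℝ (Fin 3)) 1)) P ∧ Nonempty (P ≃ₘ⟮𝓡 4, (𝓡 2).prod (𝓡 2)⟯ ((Metric.sphere (0 : EuclideanSpace ℝ (Fin 3)) 1) × (Metric.sphere (0 : EuclideanSpace ℝ (Fin 3)) 1)))) → ∃ ν : Literature.Topology.FourManifolds.FramedSphereFamily ((𝓡 2).prod (𝓡 2)) ((Metric.sphere (0 : EuclideanSpace ℝ (Fin 3)) 1) × (Metric.sphere (0 : EuclideanSpace ℝ (Fin 3)) 1)) (Fin 1) 2 2, Manifold.IsSmoothEmbedding (𝓡 2) ((𝓡 2).prod (𝓡 2)) ∞ (ν.sphere 0) ∧ (∃ (x : Metric.sphere (0 : EuclideanSpace ℝ (Fin 3)) 1) (F G : C(Metric.sphere (0 : EuclideanSpace ℝ (Fin 3)) 1, (Metric.sphere (0 : EuclideanSpace ℝ (Fin 3)) 1) × (Metric.sphere (0 : EuclideanSpace ℝ (Fin 3)) 1))), ⇑F = ν.sphere 0 ∧ ⇑G = (fun p => (x, p)) ∧ F.Homotopic G) ∧ SimplyConnectedSpace ↥(Set.range (ν.sphere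 0))ᶜ ∧ ν.IsSurgery (𝓡 4) M

/-- item stmt-SmoothPoincare4-14761 · support · rank 9 · open · by planner
sources: Federer1969, Sard1942, EvansGariepy2015, arXiv:1705.09989
[support] THEOREM A (card P1/P5, provable now on paper): a C^∞ embedded fibre-class sphere g : S² →
S²×S² with μH[2](range g) < 3 · μH[2](S²) has a ONE-SHEET HEIGHT: some y ∈ S² with exactly one p
such that (g p).2 = y, and d(pr₂ ∘ g) surjective at every such p (y a regular value) — i.e. S²×{y}
is a transverse sphere for g. Proof: deg(pr₂ ∘ g) = 1 (fibre class) so N(y) = #(pr₂ ∘ g)⁻¹(y) is odd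
≥ 1 at regular values (a.e. y, Sard); Eilenberg's inequality ∫* N dμH[2] ≤ Lip(pr₂)² μH[2](range g)
with Lip(pr₂) = 1 in the sup metric and normalisation-free constant; if N ≥ 3 a.e. then 3 μH[2](S²)
≤ μH[2](range g), contradiction. Needs Eilenberg/coarea inequality and Sard for maps S² → S² in
Mathlib form (not yet there: M-size formalisation). [difficulty: M] -/
@[route_item "route-SmoothPoincare4-ThreeFibres"]
def ThreeFibresSheet : Prop :=
  open scoped ContDiff in ∀ g : (Metric.sphere (0 : EuclideanSpace ℝ (Fin 3)) 1) → (Metric.sphere (0 : EuclideanSpace ℝ (Fin 3)) 1) × (Metric.sphere (0 : EuclideanSpace ℝ (Fin 3)) 1), Manifold.IsSmoothEmbedding (𝓡 2) ((𝓡 2).prod (𝓡 2)) ∞ g → (∃ (x : Metric.sphere (0 : EuclideanSpace ℝ (Fin 3)) 1) (F G : C(Metric.sphere (0 : EuclideanSpace ℝ (Fin 3)) 1, (Metric.sphere (0 : EuclideanSpace ℝ (Fin 3)) 1) × (Metric.sphere (0 : EuclideanSpace ℝ (Fin 3)) 1))), ⇑F = g ∧ ⇑G = (fun p => (x, p)) ∧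 F.Homotopic G) → μH[2] (Set.range g) < 3 * μH[2] (Set.univ : Set (Metric.sphere (0 : EuclideanSpace ℝ (Fin 3)) 1)) → ∃ y : Metric.sphere (0 : EuclideanSpace ℝ (Fin 3)) 1, (∃! p : Metric.sphere (0 : EuclideanSpace ℝ (Fin 3)) 1, (g p).2 = y) ∧ ∀ p : Metric.sphere (0 : EuclideanSpace ℝ (Fin 3)) 1, (g p).2 = y → Function.Surjective ⇑(mfderiv (𝓡 2) (𝓡 2) (fun q => (g q).2) p)

/-- item stmt-SmoothPoincare4-14762 · support · rank 9 · open · by planner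
sources: Gabai2020, arXiv:1705.09989, Smale1959
[support] 4D LIGHT BULB THEOREM, Diff-orbit form (Gabai2020 Thm 1.9 = 10.8, verbatim p.3: "If R is
an embedded 2-sphere in S²×S², homologous to x₀×S², that intersects S²×y₀ transversely and only at
the point (x₀, y₀), then R is isotopic to x₀×S² via an isotopy fixing S²×y₀ pointwise"; Litherland
1986 Proc. AMS 98 already gives a diffeomorphism): a C^∞ embedded fibre-class sphere g with a
one-sheet height is carried by a diffeomorphism φ of S²×S² EXACTLY onto a fibre inclusion, φ (g p) =
(x, p) (the reparametrisation σ = pr₂ ∘ Φ₁ ∘ g ∈ Diff(S²) left by the isotopy Φ₁ is absorbed into φ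
:= (id × σ⁻¹) ∘ Φ₁). XL to formalise; may be re-filed as `(h : <Gabai 1.9 named fact>) → …` once the
fact is vendored (Definition requests). [difficulty: XL] -/
@[route_item "route-SmoothPoincare4-ThreeFibres"]
def LightBulbFibre : Prop :=
  open scoped ContDiff in ∀ g : (Metric.sphere (0 : EuclideanSpace ℝ (Fin 3)) 1) → (Metric.sphere (0 : EuclideanSpace ℝ (Fin 3)) 1) × (Metric.sphere (0 : EuclideanSpace ℝ (Fin 3)) 1), Manifold.IsSmoothEmbedding (𝓡 2) ((𝓡 2).prod (𝓡 2)) ∞ g → (∃ (x : Metric.sphere (0 : EuclideanSpace ℝ (Fin 3)) 1) (F G : C(Metric.sphere (0 : EuclideanSpace ℝ (Fin 3)) 1, (Metric.sphere (0 : EuclideanSpace ℝ (Fin 3)) 1) × (Metric.sphere (0 : EuclideanSpace ℝ (Fin 3)) 1))), ⇑F = g ∧ ⇑G = (fun p => (x, p)) ∧ F.Homotopic G) → (∃ y : Metric.sphere (0 : EuclideanSpace ℝ (Fin 3)) 1, (∃! p : Metric.sphere (0 : EuclideanSpace ℝ (Fin 3)) 1, (g p).2 = y) ∧ ∀ p :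 Metric.sphere (0 : EuclideanSpace ℝ (Fin 3)) 1, (g p).2 = y → Function.Surjective ⇑(mfderiv (𝓡 2) (𝓡 2) (fun q => (g q).2) p)) → ∃ (φ : ((Metric.sphere (0 : EuclideanSpace ℝ (Fin 3)) 1) × (Metric.sphere (0 : EuclideanSpace ℝ (Fin 3)) 1)) ≃ₘ⟮(𝓡 2).prod (𝓡 2), (𝓡 2).prod (𝓡 2)⟯ ((Metric.sphere (0 : EuclideanSpace ℝ (Fin 3)) 1) × (Metric.sphere (0 : EuclideanSpace ℝ (Fin 3)) 1))) (x : Metric.sphere (0 : EuclideanSpace ℝ (Fin 3)) 1), ∀ p, φ (g p) = (x, p)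

/-- item stmt-SmoothPoincare4-14763 · support · rank 9 · open · by planner
sources: MilnorHCobordism1965, GompfStipsicz1999, Gluck1962
[support] SURGERY ON A FIBRE IS S⁴ (card P2(ii), known): if the core of a framed 2-sphere ν in Q =
S²×S² is carried by a diffeomorphism exactly onto a fibre {x}×S², then every 4-manifold M obtained
from Q by surgery along ν (tree IsSurgery, WHATEVER the framing ν carries) is diffeomorphic to S⁴.
Proof: Q = ∂(D³×S²_b) with the 2-handle's belt sphere S²_a×{b₀} met once by the fibre {x}×S²_b, so
attaching a 3-handle along the fibre with any framing cancels the 2-handle: surgery = ∂D⁵ = S⁴;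
transport along the diffeomorphism; uniqueness of open gluings up to diffeomorphism. Needs: gluing
uniqueness + one explicit model computation (L). [difficulty: L] -/
@[route_item "route-SmoothPoincare4-ThreeFibres"]
def FibreSurgerySphere : Prop :=
  open scoped ContDiff in ∀ ν : Literature.Topology.FourManifolds.FramedSphereFamily ((𝓡 2).prod (𝓡 2)) ((Metric.sphere (0 : EuclideanSpace ℝ (Fin 3)) 1) × (Metric.sphere (0 : EuclideanSpace ℝ (Fin 3)) 1)) (Fin 1) 2 2, (∃ (φ : ((Metric.sphere (0 : EuclideanSpace ℝ (Fin 3)) 1) × (Metric.sphere (0 : EuclideanSpace ℝ (Fin 3)) 1)) ≃ₘ⟮(𝓡 2).prod (𝓡 2), (𝓡 2).prod (𝓡 2)⟯ ((Metric.sphere (0 : EuclideanSpace ℝ (Fin 3)) 1) × (Metric.sphere (0 : EuclideanSpace ℝ (Fin 3)) 1))) (x : Metric.sphere (0 : EuclideanSpace ℝ (Fin 3)) 1), ∀ p, φ (ν.sphere 0 p) = (x, p)) → ∀ (M : Type) [TopologicalSpace M] [T2Space M] [SecondCountableTopology M] [ChartedSpace (EuclideanSpace ℝ (Fin 4)) M]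 [IsManifold (𝓡 4) ∞ M], ν.IsSurgery (𝓡 4) M → Nonempty (M ≃ₘ⟮𝓡 4, 𝓡 4⟯ Metric.sphere (0 : EuclideanSpace ℝ (Fin 5)) 1)

/-- item stmt-SmoothPoincare4-14764 · assembly · rank 1 · open · by planner
sources: WallJLMS1964, arXiv:1705.09989, MilnorHCobordism1965
[assembly] StabOneSuffices → SurgeryDictionary → AreaBelowThreeFibres → ThreeFibresSheet →
LightBulbFibre → FibreSurgerySphere → SmoothPoincare4 (provable now by the proof of `closes`). -/
@[route_item "route-SmoothPoincare4-ThreeFibres"]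
def Assembly : Prop :=
  StabOneSuffices → SurgeryDictionary → AreaBelowThreeFibres → ThreeFibresSheet → LightBulbFibre → FibreSurgerySphere → _root_.SmoothPoincare4

/-! D-0027 §2.1 — DECIDING THEOREM (planner-authored via `route open/edit --closes-file`; by planner-rrepair-SmoothPoincare4-ThreeFibres-3cd672f8-0 2026-08-15T20:08:45Z):
its hypotheses are this route's items and its conclusion the sub-problem Statement (glue_lint), and it elaborates with this file. -/

/-- D-0027 §2.1 deciding theorem of route ThreeFibres (rev 1, cone repair). `SmoothPoincare4` unfolds to: for every
Hausdorff second-countable `M : Type`, every `C^∞` atlas on `M` modelled on `ℝ⁴` and every `e : M ≃ₕ S⁴`,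
`Nonempty (M ≃ₘ⟮𝓡 4, 𝓡 4⟯ S⁴)`. The items are stated over exactly these binders (bare homotopy 4-sphere; no
`HomotopySphere 4` packaging, so no homotopy-sphere / h-cobordism module enters the route cone):
`StabOneSuffices` + `SurgeryDictionary` present `M` as surgery on a framed fibre-class sphere `ν` in `S²×S²` with
simply connected complement; `AreaBelowThreeFibres` moves its core below three fibres of area inside the
Diff-orbit; the composite `ψ ∘ core` is again a smooth embedding (Mathlib gap `IsSmoothEmbedding.comp` /
`Diffeomorph.isSmoothEmbedding`: proved inline below from Mathlib's chart normal form — transport the codomain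
chart along `ψ⁻¹` — so that no tree file is imported for it); `ThreeFibresSheet` (Theorem A) extracts a one-sheet
height; `LightBulbFibre` (Gabai 1.9) carries the sphere onto a fibre; `FibreSurgerySphere` returns `M ≃ₘ S⁴`.
`Target` and `Assembly` are deliberately not hypotheses. -/
@[closes "route-SmoothPoincare4-ThreeFibres"] theorem closes (h₂ : AreaBelowThreeFibres) (h₃ : StabOneSuffices) (hD : SurgeryDictionary) (hA : ThreeFibresSheet) (hL : LightBulbFibre) (hF : FibreSurgerySphere) : _root_.SmoothPoincare4 := by
  intro M _ _ _ _ _ e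
  obtain ⟨ν, hemb, hcls, hsc, hsurg⟩ := hD M e (h₃ M e)
  obtain ⟨ψ, hcls', harea⟩ := h₂ (ν.sphere 0) hemb hcls hsc
  -- `ψ ∘ core` is a smooth embedding: topological part from the homeomorphism `ψ`, immersion part by
  -- transporting the codomain chart of Mathlib's `IsImmersionAtOfComplement` normal form along `ψ.symm`.
  have hemb' : Manifold.IsSmoothEmbedding (𝓡 2) ((𝓡 2).prod (𝓡 2)) ∞ (⇑ψ ∘ ν.sphere 0) := by
    refine ⟨?_, ψ.toHomeomorph.isEmbedding.comp hemb.isEmbedding⟩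
    obtain ⟨F, _, _, hF0⟩ := hemb.isImmersion
    refine ⟨F, inferInstance, inferInstance, fun x => ?_⟩
    have h := hF0 x
    set c := ψ.symm.toHomeomorph.toOpenPartialHomeomorph ≫ₕ h.codChart with hc
    have hcatlas : c ∈ IsManifold.maximalAtlas ((𝓡 2).prod (𝓡 2)) ∞
        ((Metric.sphere (0 : EuclideanSpace ℝ (Fin 3)) 1) × (Metric.sphere (0 : EuclideanSpace ℝ (Fin 3)) 1)) := by
      rw [IsManifold.mem_maximalAtlas_iff_contMDiffOn]
      constructor
      · have h1 := contMDiffOn_of_mem_maximalAtlas h.codChart_mem_maximalAtlas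
        have : ContMDiffOn ((𝓡 2).prod (𝓡 2)) ((𝓡 2).prod (𝓡 2)) ∞ (h.codChart ∘ ψ.symm) c.source := by
          refine h1.comp ψ.symm.contMDiff.contMDiffOn ?_
          intro y hy
          simpa [hc] using hy
        exact this.congr fun y _ => by simp [hc]
      · have h1 := contMDiffOn_symm_of_mem_maximalAtlas h.codChart_mem_maximalAtlas
        have : ContMDiffOn ((𝓡 2).prod (𝓡 2)) ((𝓡 2).prod (𝓡 2)) ∞ (ψ ∘ h.codChart.symm) c.target := by
          refine ψ.contMDiff.comp_contMDiffOn (h1.mono ?_)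
          intro y hy
          simpa [hc] using hy
        exact this.congr fun y _ => by simp [hc]
    refine Manifold.IsImmersionAtOfComplement.mk_of_charts h.equiv h.domChart c h.mem_domChart_source ?_
      h.domChart_mem_maximalAtlas hcatlas ?_ ?_
    · simpa [hc] using h.mem_codChart_source
    · intro y hy
      simpa [hc] using h.source_subset_preimage_source hy
    · intro y hy
      have := h.writtenInCharts hy
      simp only [Function.comp_apply] at this ⊢
      rw [← this]
      simp [hc, OpenPartialHomeomorph.extend]
  obtain ⟨φ, x, hφ⟩ := hL (⇑ψ ∘ ν.sphere 0) hemb' hcls' (hA (⇑ψ ∘ ν.sphere 0) hemb' hcls' harea)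
  have hstd : ∃ (φ' : ((Metric.sphere (0 : EuclideanSpace ℝ (Fin 3)) 1) × (Metric.sphere (0 : EuclideanSpace ℝ (Fin 3)) 1)) ≃ₘ⟮(𝓡 2).prod (𝓡 2), (𝓡 2).prod (𝓡 2)⟯ ((Metric.sphere (0 : EuclideanSpace ℝ (Fin 3)) 1) × (Metric.sphere (0 : EuclideanSpace ℝ (Fin 3)) 1))) (x : Metric.sphere (0 : EuclideanSpace ℝ (Fin 3)) 1), ∀ p, φ' (ν.sphere 0 p) = (x, p) :=
    ⟨ψ.trans φ, x, fun p => by simpa [Diffeomorph.coe_trans, Function.comp] using hφ p⟩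
  exact hF ν hstd M hsurg

end Summit.SmoothPoincare4.SmoothPoincare4.Theses.ThreeFibres
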